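import Summits.KontsevichZagierPeriods.KontsevichZagierPeriods.Theorems.TerasomaMultiplicationGammaHodgeSectorStubProducts
import Summits.KontsevichZagierPeriods.KontsevichZagierPeriods.Theses.SelbergAMGM
import Summits.KontsevichZagierPeriods.KontsevichZagierPeriods.Theses.MotivatedMoves

/-!
# `GammaHodgeSector` (stmt-KontsevichZagierPeriods-3742) is contained in SelbergAMGM's Γ-sector
# `GammaSector` (stmt-KontsevichZagierPeriods-5620)

Route SelbergAMGM's crux 5, `GammaSector`, says that any two Beta-MONOMIAL representations (unit-cube
domains of any dimensions, integrands `C · Πᵢ tᵢ^(aᵢ−1)(1−tᵢ)^(bᵢ−1)` with `C` real algebraic and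
`aᵢ, bᵢ` positive rationals) of equal value are KZ-equivalent. The crux `GammaHodgeSector`
(TerasomaMultiplication crux 5 = MotivatedMoves crux 2, stmt-3742) compares a cube Beta
representation with a `2k`-BALL × cube representation; but the latter is equivalent, inside the
rules, to the Beta-monomial representation with `k` extra factors `(t(1−t))^{−1/2}` and constant
`c` — both have class `κ(c) · β(½,½)^k · Πₗ β(x'ₗ, y'ₗ)` in `P = FormalRep ⧸ relations` by the
landed ball peeling (`stub_products`) and cube product (`cubeProduct_holds`) theorems. Hence
`gammaHodgeSector_of_selbergGammaSector : SelbergAMGM.GammaSector → GammaHodgeSector`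
(and the MotivatedMoves copy): a cross-route containment, no hypothesis of the Hodge test used.

References: Kontsevich–Zagier 2001 §1.1–1.2; Deligne, LNM 900 §7 (Thm 7.18).
-/

noncomputable section

open MeasureTheory Set
open scoped BigOperators

namespace Summit.KontsevichZagierPeriods.GammaHodgeSectorKO

open Literature.NumberTheory.Transcendental
open Literature.NumberTheory.Transcendental.KZ
open Summit.KontsevichZagierPeriods.GammaHodgeSectorNegative (IsCubeBetaRep IsBallCubeRep
  gammaHodgeSector_iff)
open Summit.KontsevichZagierPeriods.KontsevichZagierPeriods.Theses.TerasomaMultiplication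
  (GammaHodgeSector)
open Summit.KontsevichZagierPeriods.KontsevichZagierPeriods.Theses.SelbergAMGM (GammaSector)

/-- Exponent data of the Beta-monomial form of the ball × cube representation: `k` copies of `½`
followed by the given exponents. [folklore] -/
theorem append_half_pos {N' : ℕ} (k : ℕ) (x' y' : Fin N' → ℚ) (hpos : ∀ l, 0 < x' l ∧ 0 < y' l) :
    ∀ i, 0 < Fin.append (fun _ : Fin k => (1 / 2 : ℚ)) x' i ∧
      0 < Fin.append (fun _ : Fin k => (1 / 2 : ℚ)) y' i := by
  intro i
  refine Fin.addCases (fun i => ?_) (fun l => ?_) i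
  · simp only [Fin.append_left]; norm_num
  · simp only [Fin.append_right]; exact hpos l

/-- **The ball × cube representation is a Beta monomial inside the rules**: a representation
pinned as `[unit 2k-ball × (0,1)^{N'}, c · k! · Πₗ (…)]` is KZ-equivalent to the cube
representation on `(0,1)^{k+N'}` with integrand `c · Πᵢ tᵢ^(aᵢ−1)(1−tᵢ)^(bᵢ−1)`,
`(a, b) = ((½)^k ⧺ x', (½)^k ⧺ y')` — both classes equal `κ(c) · β(½,½)^k · Πₗ β(x'ₗ,y'ₗ)` in `P`
(`stub_products`, `cubeProduct_holds`, `toFormalPeriod_of_constMul`). [cite: KontsevichZagier2001, §1.1] -/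
theorem exists_betaMonomial_of_isBallCubeRep {N' : ℕ} (k : ℕ) (x' y' : Fin N' → ℚ) (c : ℝ)
    (hc : IsAlgebraic ℚ c) (r' : IntegralRep (2 * k + N')) (hpos : ∀ l, 0 < x' l ∧ 0 < y' l)
    (hr' : IsBallCubeRep k x' y' c r') :
    ∃ (Q : IntegralRep (k + N')) (a b : Fin (k + N') → ℚ), (∀ i, 0 < a i ∧ 0 < b i) ∧
      Q.domain = {t | ∀ i, t i ∈ Set.Ioo (0:ℝ) 1} ∧
      Set.EqOn Q.integrand
        (fun t => c * ∏ i, ((t i) ^ ((a i : ℝ) - 1) * (1 - t i) ^ ((b i : ℝ) - 1))) Q.domain ∧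
      Equivalent r' Q := by
  classical
  set a : Fin (k + N') → ℚ := Fin.append (fun _ : Fin k => (1 / 2 : ℚ)) x' with ha
  set b : Fin (k + N') → ℚ := Fin.append (fun _ : Fin k => (1 / 2 : ℚ)) y' with hb
  have hab : ∀ i, 0 < a i ∧ 0 < b i := append_half_pos k x' y' hpos
  obtain ⟨q, hqd, hqi⟩ := exists_cubeBetaRep a b hab
  refine ⟨q.constMul c hc, a, b, hab, ?_, ?_, ?_⟩
  · rw [IntegralRep.domain_constMul, hqd]
  · intro t ht
    rw [IntegralRep.domain_constMul] at ht
    rw [IntegralRep.integrand_constMul]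
    show c * q.integrand t = c * _
    rw [hqi ht]
  · change of r' - of (q.constMul c hc) ∈ relations
    rw [← toFormalPeriod_eq_iff, stub_products.2.1 k x' y' c hc r' hpos hr',
      toFormalPeriod_of_constMul, cubeProduct_holds a b q hab ⟨hqd, hqi⟩, Fin.prod_univ_add]
    change _ = kap c hc * _
    simp only [ha, hb, Fin.append_left, Fin.append_right, Finset.prod_const, Finset.card_univ,
      Fintype.card_fin]
    ring

/-- **SelbergAMGM's Γ-sector contains the Γ-Hodge sector**:
`GammaSector (stmt-5620) → GammaHodgeSector (stmt-3742)`. Given an instance `(r, r')` of the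
crux, replace `r'` by its Beta-monomial form `Q` (`exists_betaMonomial_of_isBallCubeRep`; same
value by soundness); `r` is a Beta monomial with constant `1`; `GammaSector` gives `r ∼ Q`, and
`r' ∼ Q` closes the triangle. The Hodge-type test and the algebraicity of `c` play no role beyond
the pinning. [cite: Deligne1982HodgeCycles, Thm. 7.18] -/
theorem gammaHodgeSector_of_selbergGammaSector (hΓ : GammaSector) : GammaHodgeSector := by
  rw [gammaHodgeSector_iff]
  intro N N' k x y x' y' c hx hx' _ hc r r' hr hr' hv
  have hposx : ∀ j, 0 < x j ∧ 0 < y j := fun j => ⟨(hx j).1, (hx j).2.1⟩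
  have hposx' : ∀ l, 0 < x' l ∧ 0 < y' l := fun l => ⟨(hx' l).1, (hx' l).2.1⟩
  obtain ⟨Q, a, b, hab, hQd, hQi, hEq⟩ :=
    exists_betaMonomial_of_isBallCubeRep k x' y' c hc r' hposx' hr'
  have hvQ : r'.value = Q.value := Equivalent.value_eq_holds hEq
  unfold GammaSector at hΓ
  have h1 : Equivalent r Q :=
    hΓ r Q ⟨1, x, y, isAlgebraic_one, hposx, hr.1, fun t ht => by beta_reduce; rw [hr.2 ht, one_mul]⟩
      ⟨c, a, b, hc, hab, hQd, hQi⟩ (hv.trans hvQ)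
  change of r - of r' ∈ relations
  have hsplit : of r - of r' = (of r - of Q) - (of r' - of Q) := by abel
  rw [hsplit]
  exact relations.sub_mem h1 hEq

/-- The same containment for the verbatim copy of the crux in route `MotivatedMoves` (stmt-3742 is
shared; the two route decls have the same body). [cite: Deligne1982HodgeCycles, Thm. 7.18] -/
theorem gammaHodgeSector_of_selbergGammaSector' (hΓ : GammaSector) :
    Summit.KontsevichZagierPeriods.KontsevichZagierPeriods.Theses.MotivatedMoves.GammaHodgeSector :=
  gammaHodgeSector_of_selbergGammaSector hΓ

end Summit.KontsevichZagierPeriods.GammaHodgeSectorKO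

end
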